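import Summits.Ventures.HSemireg.WedgeHankelRecurrenceSynthesis
import Summits.Ventures.HSemireg.WedgeHankelSpikes

/-!
# Venture HSemireg — PRONY ∕ SYLVESTER WITH A NODE AT INFINITY: **`q` agrees on `[0, N + 1]` with `Σ_{i<r} A_i λ_i^j + c·[j = N + 1]` (distinct affine nodes plus the point at infinity)
# iff the degree-`r` node polynomial `Π_i (X − λ_i)` lies in the window-`(r + 2)` recurrence space `Rec^{N+1}_{r+1}(q)`** — the degree drop of a recurrence below its window IS the
# node `∞` (`δ_{N+1}` = the class `y^{N+1}`); weights unique

HONEST FRAMING. Part of the Lean index of the computation cell `pub-hsemireg` (seat p10 gen 26, Sunday typer «UNIFORM-IN-n»).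
LINEAR ALGEBRA OF HANKEL (catalecticant) MATRICES and of polynomials over a field ONLY: no variety, no cohomology theory, no sheaf, no Ext group and no semiregularity map is constructed
here; nothing here says that HC / HC_CM / HC_AV holds; no Literature fact is declared or used.  Custodian versions as in `WedgeHankelSiegelIdeal` (1/3); the dictionary (`secSeq A λ` = the
secant class at the affine nodes `λ_i`; `spikeSeq (N+1)` = the class of the point at infinity of the rational normal curve; «Sylvester's theorem on `P¹`») is QUOTED, never asserted.

WHAT IS IN THE TREE.  N23 (`WedgeHankelRecurrenceSynthesis`, № 176, tree): `exists_secSeq_of_prod_X_sub_C_mem_recSpace` (affine Prony synthesis), `recSpace_congr`, `weights_unique`; N19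
(`WedgeHankelRecurrenceProny`, № 174) `prod_X_sub_C_mem_recSpace_secSeq`, `natDegree_prod_X_sub_C_nodes`; N18 (№ 173) `recSpace`, `mem_recSpace_iff`, `mem_degreeLT_succ_iff`;
`WedgeHankelSpikes.spikeSeq`.  (N26's witness `charSeq m + δ_{N+1−e}` is the non-split analogue; N22's `one_mem_recSpace_rev_iff` the inversion picture.)
THIS FILE (namespace `Summit.Ventures.HSemireg.Wedge.HankelOuter` continued; PLAIN over the tree; 0 definitions):
* §500 **`mem_recSpace_succ_succ_iff`** (`deg p ≤ k ⇒ (p ∈ Rec^{N+1}_{k+1}(q) ↔ p ∈ Rec^{N}_k(q))`: one degree of slack in the window frees the top coefficient),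
  `recSpace_add_spikeSeq_of_lt` (`Rec^{N}_k` ignores a spike beyond `N`).
* §501 **`exists_secSeq_add_spike_of_prod_X_sub_C_mem_recSpace_succ`** (distinct `λ_i`, `Π_i (X − λ_i) ∈ Rec^{N+1}_{r+1}(q) ⇒ q = secSeq A λ + c·δ_{N+1}` on `[0, N+1]`),
  `prod_X_sub_C_mem_recSpace_succ_secSeq_add_spike` (converse, any weights), **`exists_secSeq_add_spike_iff_prod_X_sub_C_mem_recSpace_succ`** (THE `P¹` CRITERION for fixed affine
  nodes), **`exists_secSeq_add_spike_iff_exists_split_recurrence`** (SYLVESTER ON `P¹`: an `(r+1)`-term representation with `r` distinct affine nodes + `∞` exists iff a product of `r`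
  distinct linear factors lies in `Rec^{N+1}_{r+1}(q)`; with N23's affine criterion every configuration of `r + 1` distinct nodes on `P¹` is covered), `weights_unique_add_spike`.
READING: N18 observed that a minimal recurrence may have degree `< R(q)`; N22/N26 identified the drop with the node at infinity; this file makes it operational for synthesis — a split
square-free recurrence of degree one less than the window produces the Waring decomposition with one summand `y^{N+1}`.  Nothing Ext-side.  New names only.
-/

open Module Polynomial
open scoped Matrix Polynomial

namespace Summit.Ventures.HSemireg.Wedge.HankelOuter

open Summit.Ventures.HSemireg.Wedge Summit.Ventures.HSemireg.Wedge.Hankel Summit.Ventures.HSemireg.Wedge.HankelSecant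
  Summit.Ventures.HSemireg.Wedge.HankelSpikes

variable (K : Type*) [Field K] {N : ℕ}

/-! ## §500. Dropping the top coefficient: a recurrence of degree `< k` in window `k + 1` on `[0, N + 1]` is a recurrence of window `k` on `[0, N]` -/

/-- **`deg p ≤ k ⇒ (p ∈ Rec^{N+1}_{k+1}(q) ↔ p ∈ Rec^{N}_{k}(q))`**: the window conditions `s + (k+1) ≤ N + 1` and `s + k ≤ N` coincide, and neither reads `q_{N+1}`… except through
`⟪p, q⟫_s` with `i + s ≤ k + s ≤ N` — so the top coefficient `q_{N+1}` is free. -/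
theorem mem_recSpace_succ_succ_iff {k : ℕ} {q : ℕ → K} {p : K[X]} (hp : p ∈ Polynomial.degreeLT K (k + 1)) :
    p ∈ recSpace K (N + 1) q (k + 1) ↔ p ∈ recSpace K N q k := by
  rw [mem_recSpace_iff, mem_recSpace_iff]
  exact ⟨fun h => ⟨hp, fun s hs => h.2 s (by omega)⟩, fun h => ⟨Polynomial.degreeLT_mono (by omega) hp, fun s hs => h.2 s (by omega)⟩⟩

/-- the recurrences of window `k` on `[0, N]` do not see `q_{N+1}, q_{N+2}, …`: two sequences equal on `[0, N]` have the same `Rec^{N}_k` (N23's `recSpace_congr`, recalled for the spike). -/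
theorem recSpace_add_spikeSeq_of_lt {c : ℕ} (hc : N < c) (a : K) (q : ℕ → K) (k : ℕ) :
    recSpace K N (q + a • spikeSeq K c) k = recSpace K N q k :=
  recSpace_congr K (fun j hj => by rw [Pi.add_apply, Pi.smul_apply, spikeSeq_apply, if_neg (by omega), smul_zero, add_zero]) k

/-! ## §501. Prony synthesis with a simple node at infinity: `q = Σ_{i} A_i λ_i^• + c · δ_{N+1}` on `[0, N + 1]` iff `Π_i (X − λ_i) ∈ Rec_{r+1}(q)` -/

/-- **SYNTHESIS WITH A NODE AT INFINITY: if the node polynomial `Π_{i<r} (X − λ_i)` (degree `r`, distinct nodes) lies in the window-`(r + 2)` recurrence space `Rec^{N+1}_{r+1}(q)` — one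
degree of slack — then `q_j = Σ_i A_i λ_i^j + c · [j = N + 1]` on `[0, N + 1]`**: the affine part by N23 on `[0, N]`, the top coefficient absorbed by the spike `δ_{N+1}` = the class of the
point at infinity (`y^{N+1}`). -/
theorem exists_secSeq_add_spike_of_prod_X_sub_C_mem_recSpace_succ {r : ℕ} {lam : Fin r → K} (hlam : Function.Injective lam) {q : ℕ → K}
    (hm : (∏ i, (Polynomial.X - Polynomial.C (lam i))) ∈ recSpace K (N + 1) q (r + 1)) :
    ∃ (A : Fin r → K) (c : K), ∀ j ≤ N + 1, q j = secSeq K A lam j + c * spikeSeq K (N + 1) j := by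
  have hdeg : (∏ i, (Polynomial.X - Polynomial.C (lam i))) ∈ Polynomial.degreeLT K (r + 1) :=
    (mem_degreeLT_succ_iff K).mpr (natDegree_prod_X_sub_C_nodes K lam).le
  obtain ⟨A, hA⟩ := exists_secSeq_of_prod_X_sub_C_mem_recSpace K hlam ((mem_recSpace_succ_succ_iff K hdeg).mp hm)
  refine ⟨A, q (N + 1) - secSeq K A lam (N + 1), fun j hj => ?_⟩
  rcases Nat.lt_or_ge j (N + 1) with hlt | hge
  · rw [spikeSeq_apply, if_neg (by omega), mul_zero, add_zero]
    exact hA j (by omega)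
  · obtain rfl : j = N + 1 := by omega
    rw [spikeSeq_apply, if_pos rfl, mul_one, add_sub_cancel]

/-- conversely **a secant class plus a node at infinity, `Σ_i A_i λ_i^• + c · δ_{N+1}`, has the degree-`r` node polynomial as a recurrence of window `r + 2` on `[0, N + 1]`** (any weights). -/
theorem prod_X_sub_C_mem_recSpace_succ_secSeq_add_spike {r : ℕ} (A lam : Fin r → K) (c : K) :
    (∏ i, (Polynomial.X - Polynomial.C (lam i))) ∈ recSpace K (N + 1) (secSeq K A lam + c • spikeSeq K (N + 1)) (r + 1) := by
  have hdeg : (∏ i, (Polynomial.X - Polynomial.C (lam i))) ∈ Polynomial.degreeLT K (r + 1) :=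
    (mem_degreeLT_succ_iff K).mpr (natDegree_prod_X_sub_C_nodes K lam).le
  rw [mem_recSpace_succ_succ_iff K hdeg, recSpace_add_spikeSeq_of_lt K (Nat.lt_succ_self N)]
  exact prod_X_sub_C_mem_recSpace_secSeq K A lam

/-- **THE `P¹` FORM OF PRONY'S CRITERION (one node allowed at infinity): `q` agrees on `[0, N + 1]` with `Σ_{i<r} A_i λ_i^• + c · δ_{N+1}` for some weights iff `Π_i (X − λ_i) ∈
Rec^{N+1}_{r+1}(q)`** (distinct affine nodes `λ_i`; the degree drop `r < r + 1` of the recurrence is the node `∞`). -/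
theorem exists_secSeq_add_spike_iff_prod_X_sub_C_mem_recSpace_succ {r : ℕ} {lam : Fin r → K} (hlam : Function.Injective lam) (q : ℕ → K) :
    (∃ (A : Fin r → K) (c : K), ∀ j ≤ N + 1, q j = secSeq K A lam j + c * spikeSeq K (N + 1) j)
      ↔ (∏ i, (Polynomial.X - Polynomial.C (lam i))) ∈ recSpace K (N + 1) q (r + 1) := by
  refine ⟨?_, exists_secSeq_add_spike_of_prod_X_sub_C_mem_recSpace_succ K hlam⟩
  rintro ⟨A, c, h⟩
  rw [recSpace_congr K (q' := secSeq K A lam + c • spikeSeq K (N + 1)) (fun j hj => by rw [h j hj, Pi.add_apply, Pi.smul_apply, smul_eq_mul])]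
  exact prod_X_sub_C_mem_recSpace_succ_secSeq_add_spike K A lam c

/-- **SYLVESTER ON `P¹` (distinct nodes, at most one at infinity): `q` has an `(r + 1)`-term representation on `[0, N + 1]` by `r` distinct affine nodes plus the node at infinity iff some
product of `r` distinct linear factors lies in `Rec^{N+1}_{r+1}(q)`** — together with N23's affine criterion (a product of `r + 1` distinct linear factors in the same space) this covers
every configuration of `r + 1` distinct nodes on `P¹`. -/
theorem exists_secSeq_add_spike_iff_exists_split_recurrence {r : ℕ} (q : ℕ → K) :
    (∃ (lam : Fin r → K) (A : Fin r → K) (c : K), Function.Injective lam ∧ ∀ j ≤ N + 1, q j = secSeq K A lam j + c * spikeSeq K (N + 1) j)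
      ↔ ∃ lam : Fin r → K, Function.Injective lam ∧ (∏ i, (Polynomial.X - Polynomial.C (lam i))) ∈ recSpace K (N + 1) q (r + 1) := by
  constructor
  · rintro ⟨lam, A, c, hlam, h⟩
    exact ⟨lam, hlam, (exists_secSeq_add_spike_iff_prod_X_sub_C_mem_recSpace_succ K hlam q).mp ⟨A, c, h⟩⟩
  · rintro ⟨lam, hlam, hm⟩
    obtain ⟨A, c, h⟩ := exists_secSeq_add_spike_of_prod_X_sub_C_mem_recSpace_succ K hlam hm
    exact ⟨lam, A, c, hlam, h⟩

/-- uniqueness of the weights (affine and at infinity): `r ≤ N + 1`. -/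
theorem weights_unique_add_spike {r : ℕ} {lam : Fin r → K} (hlam : Function.Injective lam) (hrN : r ≤ N + 1) {A B : Fin r → K} {c d : K}
    (h : ∀ j ≤ N + 1, secSeq K A lam j + c * spikeSeq K (N + 1) j = secSeq K B lam j + d * spikeSeq K (N + 1) j) : A = B ∧ c = d := by
  have hAB : A = B := weights_unique K hlam hrN fun j hj => by
    have := h j (by omega)
    rwa [spikeSeq_apply, if_neg (by omega), mul_zero, add_zero, mul_zero, add_zero] at this
  refine ⟨hAB, ?_⟩
  have := h (N + 1) le_rfl
  rwa [hAB, spikeSeq_apply, if_pos rfl, mul_one, mul_one, add_right_inj] at this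

end Summit.Ventures.HSemireg.Wedge.HankelOuter
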